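import Literature.Analysis.FluidPDE.PassiveVectorTensorTwoProblemDuality
import Literature.Analysis.FluidPDE.PassiveVectorTensorPropagatorUnique
import HarnessLib

/-!
# K1L_D (stmt-AnomalousDissipation-27980), line «onelevel-design», brick Z1 of memo L7 at the PROPAGATOR level:
# the window-error duality identity for two `Torus.IsPropagator` families (helper; `--supports … --as helper`; lead-k1l-onelevel-p1 g4)

Memo `Cruxes/LagrangianRenormalisationStep/Lines/onelevel-L7-Zin-operator-route.md` §0 (Z1): the one-window error of the coarse
propagator against the true one, paired with a test vector, is the time integral of the CROSS DENSITY of the two-problem duality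
(ad-lit g27's `Torus.IsWeakTensorPassiveVectorOn.twoProblemDuality_traces`, p678566) between the true solution restarted at the
window's left end and the coarse ADJOINT solution started from the test vector at the window's right end.  This file lifts that
identity from weak solutions to the abstract solution operators of `Torus.IsPropagator` (the currency of the registered §9 texts):
for two propagator families `U₁` (tensor `𝔸₁`, carrier `b₁`) and `U₂` (tensor `𝔸₂`, carrier `b₂`) on `[0,T]` over the same torus,
`0 ≤ s < t ≤ T`, an `L²` weakly divergence-free datum `φ` and test class `y`,

  `⟪U₁ s t φ, y⟫ − ⟪U₂ s t φ, y⟫ = ∫_{(0,t−s]} Σ'ₖ Re( −4π² ⟪ŵ(σ)(k), (T_{𝔸₁}(k) − T_{𝔸₂}(k)) ψ̂(t−s−σ)(k)⟫ + Σⱼ 2πikⱼ ⟪𝓕((b₁−b₂)ⱼ(s+σ) w(σ))(k), ψ̂(t−s−σ)(k)⟫ ) dσ`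

for EVERY weak solution `w` of problem 1 on the window (carrier `τ ↦ b₁ (s+τ)`, datum `φ`) and EVERY weak solution `ψ` of the adjoint of
problem 2 on the window (tensor `𝔸₂ᵀ`, carrier `r ↦ −b₂ (t−r)`, datum `y`) — `inner_sub_eq_setIntegral_crossDensity`; the `Lp`-datum
form `inner_sub_eq_setIntegral_crossDensity'`; and the existential form `exists_sol_adj_inner_sub_eq` (Lions existence supplies `w, ψ`).
The integrand is written out (it is the cross density of `twoProblemDuality`); the named def `crossDensity` and the restatements through it
ride in the companion review-lane file `…LagrangianStepWindowDualityDefs`.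
Ingredients: Z1′ endpoint form, `IsPropagator.repr`/`continuousOn` (the continuous representative of `τ ↦ ∫⟪w τ, y⟫` is
`τ ↦ ⟪U₁ s (s+τ) φ, y⟫`), and `IsPropagator.inner_eq_inner_propagator_reversed` (the continuous representative of `r ↦ ∫⟪ψ r, φ⟫` is the
pairing with the concrete backward propagator, whose value at `r = t − s` is `⟪U₂ s t φ, y⟫`).  Brick Z2 of L7 (membership of the
difference in a forced class) is thereby unnecessary.  Consumer: the §9a–§9c parts of `stub_cellInputs` with `U₁ = Um1` (true: carrier
`E.partialSum (m+1)`, tensor `kbar(m+1)•S`), `U₂ = Um` (coarse: carrier `E.partialSum m`, tensor `kbar m • renormStep …`).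
NOT a proof of any registered stub, of the crux, or of AD; rung F-D1.A0.
-/

set_option linter.dupNamespace false  -- the summit-side namespace `Summit.AnomalousDissipation.AnomalousDissipation.…` repeats a component by design (D-0017)

noncomputable section

namespace Summit.AnomalousDissipation.AnomalousDissipation.Theorems.SolenoidalFractalHomogenisation.LagrangianStep.WindowDuality

open Literature.Analysis Literature.Analysis.FluidPDE Literature.Analysis.FluidPDE.Torus Literature.Analysis.FunctionSpaces
open MeasureTheory Set Filter Complex UnitAddTorus
open scoped ENNReal NNReal InnerProductSpace

variable {d : Type*} [Fintype d] [DecidableEq d]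

omit [DecidableEq d] in
/-- The essential bound of a carrier on `(0,T) × T^d` passes to the shifted carrier `τ ↦ b (s + τ)` on `(0, T − s) × T^d`
(translation is measure preserving; copy of the private lemma of `PassiveVectorTensorPropagator`). -/
theorem memLp_top_stLift_comp_add_left {b : ℝ → UnitAddTorus d → EuclideanSpace ℝ d} {T : ℝ}
    (hb : MemLp (FunctionSpaces.Torus.stLift b) ∞ (volume.restrict (Ioo 0 T ×ˢ univ))) {s : ℝ} (hs : 0 ≤ s) :
    MemLp (FunctionSpaces.Torus.stLift (fun τ => b (s + τ))) ∞ (volume.restrict (Ioo 0 (T - s) ×ˢ univ)) := by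
  set θ : ℝ × EuclideanSpace ℝ d → ℝ × EuclideanSpace ℝ d := fun p => (s + p.1, p.2) with hθ
  have hθmp : MeasurePreserving θ (volume : Measure (ℝ × EuclideanSpace ℝ d)) volume := by
    have h := (measurePreserving_add_left (volume : Measure ℝ) s).prod
      (MeasurePreserving.id (volume : Measure (EuclideanSpace ℝ d)))
    have e : Prod.map (fun t : ℝ => s + t) id = θ := by
      funext p; rfl
    rw [e] at h
    exact h
  have hpre : θ ⁻¹' (Ioo s T ×ˢ univ) = Ioo 0 (T - s) ×ˢ univ := by
    ext p
    simp only [hθ, mem_preimage, mem_prod, mem_univ, and_true, mem_Ioo]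
    constructor <;> rintro ⟨h1, h2⟩ <;> constructor <;> linarith
  have hθr : MeasurePreserving θ (volume.restrict (Ioo 0 (T - s) ×ˢ univ)) (volume.restrict (Ioo s T ×ˢ univ)) := by
    have h := hθmp.restrict_preimage (measurableSet_Ioo.prod MeasurableSet.univ) (s := Ioo s T ×ˢ univ)
    rwa [hpre] at h
  have hb₀ : MemLp (FunctionSpaces.Torus.stLift b) ∞ (volume.restrict (Ioo s T ×ˢ univ)) :=
    hb.mono_measure (Measure.restrict_mono (prod_mono (Ioo_subset_Ioo hs le_rfl) le_rfl) le_rfl)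
  have hcomp : MemLp (FunctionSpaces.Torus.stLift b ∘ θ) ∞ (volume.restrict (Ioo 0 (T - s) ×ˢ univ)) :=
    hb₀.comp_measurePreserving hθr
  have e : FunctionSpaces.Torus.stLift (fun τ => b (s + τ)) = FunctionSpaces.Torus.stLift b ∘ θ := by
    funext p
    simp only [FunctionSpaces.Torus.stLift, hθ, Function.comp_apply]
  rw [e]
  exact hcomp

omit [DecidableEq d] in
/-- The a.e. weak divergence-freeness of a carrier passes to the shifted carrier `τ ↦ b (s + τ)` on `(0, T − s)`. -/
theorem ae_isWeaklyDivFree_comp_add_left {b : ℝ → UnitAddTorus d → EuclideanSpace ℝ d} {T : ℝ}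
    (hbdiv : ∀ᵐ t ∂(volume.restrict (Ioo 0 T)), FunctionSpaces.Torus.IsWeaklyDivFree (b t)) {s : ℝ} (hs : 0 ≤ s) :
    ∀ᵐ τ ∂(volume.restrict (Ioo 0 (T - s))), FunctionSpaces.Torus.IsWeaklyDivFree (b (s + τ)) :=
  ae_restrict_Ioo_comp_add_left (P := fun t => FunctionSpaces.Torus.IsWeaklyDivFree (b t)) hbdiv hs (by linarith)

omit [DecidableEq d] in
/-- `⟪toLp f, z⟫ = ∫⟪f, z⟫` for `f ∈ L²`. -/
theorem inner_toLp_left {f : UnitAddTorus d → EuclideanSpace ℝ d} (hf : MemLp f 2 volume)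
    (z : Lp (EuclideanSpace ℝ d) 2 (volume : Measure (UnitAddTorus d))) :
    ⟪hf.toLp f, z⟫_ℝ = ∫ x, ⟪f x, (z : UnitAddTorus d → EuclideanSpace ℝ d) x⟫_ℝ := by
  rw [MeasureTheory.L2.inner_def]
  exact integral_congr_ae (hf.coeFn_toLp.mono fun x hx => by simp only [hx])

omit [DecidableEq d] in
/-- `⟪toLp f, toLp g⟫ = ∫⟪f, g⟫` for `f, g ∈ L²`. -/
theorem inner_toLp_toLp {f g : UnitAddTorus d → EuclideanSpace ℝ d} (hf : MemLp f 2 volume) (hg : MemLp g 2 volume) :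
    ⟪hf.toLp f, hg.toLp g⟫_ℝ = ∫ x, ⟪f x, g x⟫_ℝ := by
  rw [MeasureTheory.L2.inner_def]
  refine integral_congr_ae ?_
  filter_upwards [hf.coeFn_toLp, hg.coeFn_toLp] with x hx hx'
  simp only [hx, hx']

variable [Nonempty d]

variable {T : ℝ} {𝔸₁ 𝔸₂ : Visc4 d} {lo hi : ℝ} {b₁ b₂ : ℝ → UnitAddTorus d → EuclideanSpace ℝ d}
  {U₁ U₂ : ℝ → ℝ → (Lp (EuclideanSpace ℝ d) 2 (volume : Measure (UnitAddTorus d)) →L[ℝ]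
    Lp (EuclideanSpace ℝ d) 2 (volume : Measure (UnitAddTorus d)))}

/-- **Z1 at the propagator level — the WINDOW-ERROR DUALITY IDENTITY.**  Let `U₁, U₂` be solution-operator families (`Torus.IsPropagator`)
on `[0,T]` of the problems with (Legendre–Hadamard) tensors `𝔸₁, 𝔸₂` and essentially bounded, a.e. weakly divergence-free carriers `b₁, b₂`;
let `0 ≤ s < t ≤ T`, let `φ ∈ L²` be weakly divergence free and `y ∈ L²` weakly divergence free.  Then for EVERY weak solution `w` of
problem 1 on the window `[s,T)` from `φ` (carrier `τ ↦ b₁ (s + τ)`) and EVERY weak solution `ψ` of the adjoint of problem 2 on `[0, t − s)`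
from `y` (tensor `𝔸₂ᵀ`, carrier `r ↦ −b₂ (t − r)`):
`⟪U₁ s t φ, y⟫ − ⟪U₂ s t φ, y⟫ = ∫_{(0,t−s]} Σ'ₖ Re( −4π² ⟪ŵ(σ)(k), (T_{𝔸₁}(k) − T_{𝔸₂}(k)) ψ̂(t−s−σ)(k)⟫ + Σⱼ 2πikⱼ ⟪𝓕((b₁−b₂)ⱼ(s+σ) w(σ))(k), ψ̂(t−s−σ)(k)⟫ ) dσ`
(the integrand is the cross density of `twoProblemDuality`; a named `crossDensity` def rides in the companion defs file). -/
theorem inner_sub_eq_setIntegral_crossDensity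
    (hU₁ : IsPropagator T b₁ 𝔸₁ U₁) (hU₂ : IsPropagator T b₂ 𝔸₂ U₂)
    (h𝔸₁ : NearIso 𝔸₁ lo hi) (h𝔸₂ : NearIso 𝔸₂ lo hi) (hlo : 0 < lo)
    (hb₁ : MemLp (FunctionSpaces.Torus.stLift b₁) ∞ (volume.restrict (Ioo 0 T ×ˢ univ)))
    (hb₂ : MemLp (FunctionSpaces.Torus.stLift b₂) ∞ (volume.restrict (Ioo 0 T ×ˢ univ)))
    (hb₂div : ∀ᵐ τ ∂(volume.restrict (Ioo 0 T)), FunctionSpaces.Torus.IsWeaklyDivFree (b₂ τ))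
    {s t : ℝ} (hs : 0 ≤ s) (hst : s < t) (htT : t ≤ T)
    {φ : UnitAddTorus d → EuclideanSpace ℝ d} (hφ : MemLp φ 2 volume) (hφdiv : FunctionSpaces.Torus.IsWeaklyDivFree φ)
    (y : Lp (EuclideanSpace ℝ d) 2 (volume : Measure (UnitAddTorus d)))
    (hydiv : FunctionSpaces.Torus.IsWeaklyDivFree (y : UnitAddTorus d → EuclideanSpace ℝ d))
    {w : ℝ → UnitAddTorus d → EuclideanSpace ℝ d}
    (hw : IsWeakTensorPassiveVectorOn 0 (T - s) 𝔸₁ (fun τ => b₁ (s + τ)) φ w)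
    {ψ : ℝ → UnitAddTorus d → EuclideanSpace ℝ d}
    (hψ : IsWeakTensorPassiveVectorOn 0 (t - s) (majorTranspose 𝔸₂) (fun r => -b₂ (t - r))
      (y : UnitAddTorus d → EuclideanSpace ℝ d) ψ) :
    ⟪U₁ s t (hφ.toLp φ), y⟫_ℝ - ⟪U₂ s t (hφ.toLp φ), y⟫_ℝ =
      ∫ σ in Ioc 0 (t - s), ∑' k : d → ℤ,
          ((-(4 * Real.pi ^ 2 : ℝ) : ℂ) *
              ⟪mFourierCoeff (EuclideanSpace.complexify ∘ w σ) k,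
                symbT 𝔸₁ k (mFourierCoeff (EuclideanSpace.complexify ∘ ψ (t - s - σ)) k)
                  - symbT 𝔸₂ k (mFourierCoeff (EuclideanSpace.complexify ∘ ψ (t - s - σ)) k)⟫_ℂ +
            ∑ j, (2 * Real.pi * I * (k j)) *
              ⟪mFourierCoeff (EuclideanSpace.complexify ∘ fun x => (b₁ (s + σ) x j - b₂ (s + σ) x j) • w σ x) k,
                mFourierCoeff (EuclideanSpace.complexify ∘ ψ (t - s - σ)) k⟫_ℂ).re := by
  have hsT : s < T := lt_of_lt_of_le hst htT
  have hts : 0 < t - s := sub_pos.2 hst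
  have htsT : t - s ≤ T - s := by linarith
  -- shifted carriers on the window
  have hb₁' := memLp_top_stLift_comp_add_left hb₁ hs
  have hb₂' := memLp_top_stLift_comp_add_left hb₂ hs
  -- the adjoint solution, with its carrier written through the shifted carrier of problem 2
  have hψ' : IsWeakTensorPassiveVectorOn 0 (t - s) (majorTranspose 𝔸₂) (fun r => -(fun τ => b₂ (s + τ)) (t - s - r))
      (y : UnitAddTorus d → EuclideanSpace ℝ d) ψ := by
    have e : (fun r => -(fun τ => b₂ (s + τ)) (t - s - r)) = fun r => -b₂ (t - r) := by
      funext r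
      ring_nf
    rw [e]; exact hψ
  -- the continuous representative of `τ ↦ ∫⟪w τ, y⟫`: the propagator pairing
  set g : ℝ → ℝ := fun τ => ⟪U₁ s (s + τ) (hφ.toLp φ), y⟫_ℝ with hg_def
  have hgc : ContinuousOn g (Icc 0 (T - s)) := by
    have h := hU₁.continuousOn s hs hsT.le (hφ.toLp φ) y
    refine (h.comp (continuousOn_const.add continuousOn_id) fun τ' hτ' => ?_)
    exact ⟨by simpa using hτ'.1, by linarith [hτ'.2]⟩
  have hg : ∀ᵐ τ ∂(volume.restrict (Ioo 0 (T - s))),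
      ∫ x, ⟪w τ x, (y : UnitAddTorus d → EuclideanSpace ℝ d) x⟫_ℝ = g τ := by
    filter_upwards [hU₁.repr s hs hsT φ hφ hφdiv w hw] with τ hτ
    obtain ⟨hm, he⟩ := hτ
    rw [hg_def]
    simp only
    rw [← he, inner_toLp_left]
  -- the concrete backward propagator of problem 2 on the window and the continuous representative of `r ↦ ∫⟪ψ r, φ⟫`
  have h𝔸₂' : NearIso (majorTranspose 𝔸₂) lo hi := (nearIso_majorTranspose_iff 𝔸₂ lo hi).2 h𝔸₂
  have hB := memLp_top_stLift_reversed_window hb₂ hs htT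
  have hBdiv := ae_isWeaklyDivFree_reversed_window hb₂div hs htT
  have hŨ := isPropagator_propagator (T := t - s) (b := fun r => -b₂ (t - r)) h𝔸₂' hlo hB hBdiv
  set h : ℝ → ℝ := fun r => ⟪propagator (T := t - s) (b := fun r => -b₂ (t - r)) h𝔸₂' hlo hB hBdiv 0 r y, hφ.toLp φ⟫_ℝ
    with hh_def
  have hhc : ContinuousOn h (Icc 0 (t - s)) := hŨ.continuousOn 0 le_rfl hts.le y (hφ.toLp φ)
  have hh : ∀ᵐ r ∂(volume.restrict (Ioo 0 (t - s))), ∫ x, ⟪ψ r x, φ x⟫_ℝ = h r := by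
    have hψ₀ : IsWeakTensorPassiveVectorOn 0 (t - s - 0) (majorTranspose 𝔸₂) (fun τ => (fun r => -b₂ (t - r)) (0 + τ))
        (y : UnitAddTorus d → EuclideanSpace ℝ d) ψ := by
      have e1 : (t - s - 0 : ℝ) = t - s := sub_zero _
      have e2 : (fun τ => (fun r => -b₂ (t - r)) (0 + τ)) = fun r => -b₂ (t - r) := by
        funext τ; simp only [zero_add]
      rw [e1, e2]; exact hψ
    have r := hŨ.repr 0 le_rfl hts (y : UnitAddTorus d → EuclideanSpace ℝ d) (Lp.memLp y) hydiv ψ hψ₀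
    rw [sub_zero] at r
    filter_upwards [r] with τ hτ
    obtain ⟨hm, he⟩ := hτ
    rw [zero_add, Lp.toLp_coeFn] at he
    rw [hh_def]
    simp only
    rw [← he, inner_toLp_toLp]
  -- Z1′ endpoint form
  have key := hw.twoProblemDuality_traces hts htsT hψ' h𝔸₁ h𝔸₂ hlo hφ hφdiv (Lp.memLp y) hydiv hb₁' hb₂' hgc hg hhc hh
  -- identify the endpoint values
  have eg : g (t - s) = ⟪U₁ s t (hφ.toLp φ), y⟫_ℝ := by
    rw [hg_def]
    simp only [add_sub_cancel]
  have eh : h (t - s) = ⟪U₂ s t (hφ.toLp φ), y⟫_ℝ := by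
    rw [hh_def]
    simp only
    rw [real_inner_comm, hU₂.inner_eq_inner_propagator_reversed h𝔸₂ hlo hb₂ hb₂div hs hst htT (hφ.toLp φ) y]
  rw [← eg, ← eh, key]

/-- **Z1 at the propagator level, `Lp`-datum form**: the same identity for a weakly divergence-free datum class `x ∈ L²`
(`w` a weak solution of problem 1 on the window from the representative `⇑x`). -/
theorem inner_sub_eq_setIntegral_crossDensity'
    (hU₁ : IsPropagator T b₁ 𝔸₁ U₁) (hU₂ : IsPropagator T b₂ 𝔸₂ U₂)
    (h𝔸₁ : NearIso 𝔸₁ lo hi) (h𝔸₂ : NearIso 𝔸₂ lo hi) (hlo : 0 < lo)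
    (hb₁ : MemLp (FunctionSpaces.Torus.stLift b₁) ∞ (volume.restrict (Ioo 0 T ×ˢ univ)))
    (hb₂ : MemLp (FunctionSpaces.Torus.stLift b₂) ∞ (volume.restrict (Ioo 0 T ×ˢ univ)))
    (hb₂div : ∀ᵐ τ ∂(volume.restrict (Ioo 0 T)), FunctionSpaces.Torus.IsWeaklyDivFree (b₂ τ))
    {s t : ℝ} (hs : 0 ≤ s) (hst : s < t) (htT : t ≤ T)
    (x y : Lp (EuclideanSpace ℝ d) 2 (volume : Measure (UnitAddTorus d)))
    (hxdiv : FunctionSpaces.Torus.IsWeaklyDivFree (x : UnitAddTorus d → EuclideanSpace ℝ d))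
    (hydiv : FunctionSpaces.Torus.IsWeaklyDivFree (y : UnitAddTorus d → EuclideanSpace ℝ d))
    {w : ℝ → UnitAddTorus d → EuclideanSpace ℝ d}
    (hw : IsWeakTensorPassiveVectorOn 0 (T - s) 𝔸₁ (fun τ => b₁ (s + τ)) (x : UnitAddTorus d → EuclideanSpace ℝ d) w)
    {ψ : ℝ → UnitAddTorus d → EuclideanSpace ℝ d}
    (hψ : IsWeakTensorPassiveVectorOn 0 (t - s) (majorTranspose 𝔸₂) (fun r => -b₂ (t - r))
      (y : UnitAddTorus d → EuclideanSpace ℝ d) ψ) :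
    ⟪U₁ s t x, y⟫_ℝ - ⟪U₂ s t x, y⟫_ℝ =
      ∫ σ in Ioc 0 (t - s), ∑' k : d → ℤ,
          ((-(4 * Real.pi ^ 2 : ℝ) : ℂ) *
              ⟪mFourierCoeff (EuclideanSpace.complexify ∘ w σ) k,
                symbT 𝔸₁ k (mFourierCoeff (EuclideanSpace.complexify ∘ ψ (t - s - σ)) k)
                  - symbT 𝔸₂ k (mFourierCoeff (EuclideanSpace.complexify ∘ ψ (t - s - σ)) k)⟫_ℂ +
            ∑ j, (2 * Real.pi * I * (k j)) *
              ⟪mFourierCoeff (EuclideanSpace.complexify ∘ fun x => (b₁ (s + σ) x j - b₂ (s + σ) x j) • w σ x) k,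
                mFourierCoeff (EuclideanSpace.complexify ∘ ψ (t - s - σ)) k⟫_ℂ).re := by
  have h := inner_sub_eq_setIntegral_crossDensity hU₁ hU₂ h𝔸₁ h𝔸₂ hlo hb₁ hb₂ hb₂div hs hst htT (Lp.memLp x) hxdiv y hydiv hw hψ
  rwa [Lp.toLp_coeFn] at h

/-- **Z1 at the propagator level, existential form**: weak solutions `w` (problem 1 on the window from `⇑x`) and `ψ` (adjoint of problem 2
from `⇑y`) EXIST (Lions), and for them the window-error duality identity holds. -/
theorem exists_sol_adj_inner_sub_eq
    (hU₁ : IsPropagator T b₁ 𝔸₁ U₁) (hU₂ : IsPropagator T b₂ 𝔸₂ U₂)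
    (h𝔸₁ : NearIso 𝔸₁ lo hi) (h𝔸₂ : NearIso 𝔸₂ lo hi) (hlo : 0 < lo)
    (hb₁ : MemLp (FunctionSpaces.Torus.stLift b₁) ∞ (volume.restrict (Ioo 0 T ×ˢ univ)))
    (hb₁div : ∀ᵐ τ ∂(volume.restrict (Ioo 0 T)), FunctionSpaces.Torus.IsWeaklyDivFree (b₁ τ))
    (hb₂ : MemLp (FunctionSpaces.Torus.stLift b₂) ∞ (volume.restrict (Ioo 0 T ×ˢ univ)))
    (hb₂div : ∀ᵐ τ ∂(volume.restrict (Ioo 0 T)), FunctionSpaces.Torus.IsWeaklyDivFree (b₂ τ))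
    {s t : ℝ} (hs : 0 ≤ s) (hst : s < t) (htT : t ≤ T)
    (x y : Lp (EuclideanSpace ℝ d) 2 (volume : Measure (UnitAddTorus d)))
    (hxdiv : FunctionSpaces.Torus.IsWeaklyDivFree (x : UnitAddTorus d → EuclideanSpace ℝ d))
    (hydiv : FunctionSpaces.Torus.IsWeaklyDivFree (y : UnitAddTorus d → EuclideanSpace ℝ d)) :
    ∃ w ψ : ℝ → UnitAddTorus d → EuclideanSpace ℝ d,
      IsWeakTensorPassiveVectorOn 0 (T - s) 𝔸₁ (fun τ => b₁ (s + τ)) (x : UnitAddTorus d → EuclideanSpace ℝ d) w ∧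
      IsWeakTensorPassiveVectorOn 0 (t - s) (majorTranspose 𝔸₂) (fun r => -b₂ (t - r))
        (y : UnitAddTorus d → EuclideanSpace ℝ d) ψ ∧
      (∀ᵐ τ ∂(volume.restrict (Ioo 0 (T - s))), ∃ hτ : MemLp (w τ) 2 volume, hτ.toLp (w τ) = U₁ s (s + τ) x) ∧
      ⟪U₁ s t x, y⟫_ℝ - ⟪U₂ s t x, y⟫_ℝ =
        ∫ σ in Ioc 0 (t - s), ∑' k : d → ℤ,
          ((-(4 * Real.pi ^ 2 : ℝ) : ℂ) *
              ⟪mFourierCoeff (EuclideanSpace.complexify ∘ w σ) k,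
                symbT 𝔸₁ k (mFourierCoeff (EuclideanSpace.complexify ∘ ψ (t - s - σ)) k)
                  - symbT 𝔸₂ k (mFourierCoeff (EuclideanSpace.complexify ∘ ψ (t - s - σ)) k)⟫_ℂ +
            ∑ j, (2 * Real.pi * I * (k j)) *
              ⟪mFourierCoeff (EuclideanSpace.complexify ∘ fun x => (b₁ (s + σ) x j - b₂ (s + σ) x j) • w σ x) k,
                mFourierCoeff (EuclideanSpace.complexify ∘ ψ (t - s - σ)) k⟫_ℂ).re := by
  have hsT : s < T := lt_of_lt_of_le hst htT
  have hts : 0 < t - s := sub_pos.2 hst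
  obtain ⟨w, hw⟩ := exists_isWeakTensorPassiveVectorOn (sub_pos.2 hsT) h𝔸₁ hlo (memLp_top_stLift_comp_add_left hb₁ hs)
    (ae_isWeaklyDivFree_comp_add_left hb₁div hs) (Lp.memLp x) hxdiv
  have h𝔸₂' : NearIso (majorTranspose 𝔸₂) lo hi := (nearIso_majorTranspose_iff 𝔸₂ lo hi).2 h𝔸₂
  obtain ⟨ψ, hψ⟩ := exists_isWeakTensorPassiveVectorOn hts h𝔸₂' hlo (memLp_top_stLift_reversed_window hb₂ hs htT)
    (ae_isWeaklyDivFree_reversed_window hb₂div hs htT) (Lp.memLp y) hydiv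
  refine ⟨w, ψ, hw, hψ, ?_, inner_sub_eq_setIntegral_crossDensity' hU₁ hU₂ h𝔸₁ h𝔸₂ hlo hb₁ hb₂ hb₂div hs hst htT x y hxdiv hydiv hw hψ⟩
  have r := hU₁.repr s hs hsT (x : UnitAddTorus d → EuclideanSpace ℝ d) (Lp.memLp x) hxdiv w hw
  filter_upwards [r] with τ hτ
  obtain ⟨hm, he⟩ := hτ
  exact ⟨hm, by rw [he, Lp.toLp_coeFn]⟩

end Summit.AnomalousDissipation.AnomalousDissipation.Theorems.SolenoidalFractalHomogenisation.LagrangianStep.WindowDuality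

end
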